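import Summits.BirchSwinnertonDyer.BirchSwinnertonDyer.Theorems.ErratumRoadFiveIMCDivGeneratorRoad
import HarnessLib

/-!
# Route `ErratumRoadFive`, crux `IMCDivAtErratumDataAll` (item stmt-BirchSwinnertonDyer-19270, H3♭),
# stubs S2 `stub_imcDivErratum_splitAtP` ∕ S1: ROAD G END FORM WITH BOTH COLEMAN COKERNELS («two copies»)
# — the form in which the printed explicit reciprocity law actually feeds it; CORRECTION of the
# provenance gloss of `ErratumRoadFiveIMCDivGeneratorRoad` §2–§3
# (cell `bsd-stepL`, PART 1b ACCEL seat `bsd-stepL-imc24b` g2; `--supports stmt-BirchSwinnertonDyer-19270`, helper; Theses-free)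

THEOREMS ONLY (no definition, no named fact, no `sorry`); module theory with the cohomological
inputs as HYPOTHESES on abstract `Λ`-modules; nothing asserted about the objects.

## Correction (same seat, same session, before any consumer)

`ErratumRoadFiveIMCDivGeneratorRoad` (p471922) §2–§3 take ONE hypothesis (ERL)
`φ(e(loc z))·w = u·Q` and gloss it as «Cas24 Thm. 2.2 ∕ Cor. 2.3 with `Q` = the frame of
`R1.IsBDPLFunctionInt`». That gloss is OFF BY A SQUARE and is withdrawn here: the frame `Q` of
`R1.IsBDPLFunctionInt` ∕ Cas18 Thm. 3.1 interpolates the central L-VALUES (value at `𝟙`: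
`u·((1 − a_p p⁻¹)·log_ω P)²`, Cas18 Thm. 3.2 = the tree's `R1.BDPValueAtOneIntAt`), i.e. it is the
SQUARE `𝓛_𝔭(f)²` of the series `𝓛_𝔭(f)` of Castella, *On the exceptional specializations of big
Heegner points*, J. Inst. Math. Jussieu 17 (2018) [cas-split], Thm. 2.10 («`L_𝔭(f)(χ)²/Ω_p^{2(k+2j)} =
(1 − a_p(f)χ⁻¹(𝔭̄))²·L_alg(f,χ⁻¹,0)`») and Thm. 2.11 (value LINEAR in `AJ_F = log`), and it is
`𝓛_𝔭(f)` — not its square — that the Coleman map hits: Cas24 (arXiv:2409.01360) Thm. 2.2 ∕ Cor. 2.3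
`𝓛̃_𝔭(loc_𝔭(κ_∞^*)) = L_𝔭(f)·unit` with «`L_𝔭(f)` … as extended in [hsieh, cas-split]»; likewise
Castella JLMS 96 (2017) Thm. A.1 `L⁺(res_𝔭(𝐳_f)) = −L_𝔭^{BDP}·σ` against (A.9)
`Ch(X_{∅,0}) ⊇ (L_𝔭^{BDP})²`. Read with the printed ERL, p471922's END FORM therefore yields
`Ch_Λ(X_ac^∅)·Λ' ⊆ (𝓛)` — HALF of (2.4) `⊆ (𝓛²) = (Q)`. The theorems of p471922 are correct as stated
(module theory); only the gloss of which printed statement discharges (ERL) for the crux's `Q` is wrong.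

## The full bookkeeping (Castella JLMS17 App. A, mirrored at the tree's `Sel_𝔭` = strict at `𝔭`, relaxed at `𝔭̄`)

The second factor `𝓛` comes from the SECOND Coleman cokernel, sitting inside the quotient:
* (A.7)′ `0 → coker(loc_𝔭̄ : 𝔖 → H¹_Gr(K_𝔭̄, 𝐓)) → X_{0,∅} → X_{0,Gr} → 0` (global duality);
* Lemma 2.3 (3)′ `Ch_Λ(X_{0,Gr}) = Ch_Λ((X_{∅,Gr})_tors)` (Mazur–Rubin [MR04, Lem. 3.5.3, Thm. 4.1.13]
  character by character, as in [AH06, §1.2]);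
* (A.5) `0 → coker(loc_𝔭 : 𝔖 → H¹_Gr(K_𝔭, 𝐓)) → X_{∅,Gr} → X → 0`, `X` of rank one, so at every
  height-one prime `ℓ((X_{∅,Gr})_tors) = ℓ(coker loc_𝔭) + ℓ(X_tors) ≥ ℓ(coker loc_𝔭)`;
* (GEN) `𝔖 = Λ·κ_∞^*` ⟹ `coker(loc_v) = H¹_Gr(K_v,𝐓)/Λ·loc_v(κ_∞^*) ≅ Λ/(a_v)` (`H¹_Gr(K_v, 𝐓)` free
  of rank one), (ERL at `v = 𝔭, 𝔭̄`) `φ(a_v) = 𝓛_v·unit`, and `𝓛_𝔭·𝓛_𝔭̄ = Q·unit` (the frame is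
  `𝓛_𝔭(f)²`; `𝓛_𝔭̄ = 𝓛_𝔭^ι` up to a unit by complex conjugation ∕ the functional equation).
Hence `Ch(X_{0,∅}) = (a_𝔭̄)·Ch(X_{0,Gr}) ⊆ (a_𝔭̄)·(a_𝔭)` and `Ch(X_{0,∅})·Λ' ⊆ (𝓛_𝔭̄ 𝓛_𝔭) = (Q)`:
(2.4) IN FULL at generator data, and in general (2.4) ⟺ `ℓ_𝔓(X_tors) ≥ ℓ_𝔓(𝔖∕Λκ^*) + ℓ_{𝔓}((𝔖∕Λκ^*)^ι)`
— the `Λ`-adic Kolyvagin-structure lower bound, with content exactly on `supp(𝔖 ∕ Λκ_∞^*)`.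

## What is proved

* §1 `GeneratorRoad.charIdeal_le_span_mul_of_injective_of_quotient_le` — `R⧸(a) ↪ X` and
  `char(X ⧸ R⧸(a)) ⊆ J` ⟹ `char(X) ⊆ (a)·J` (multiplicativity); the two-factor units transport.
* §2 `GeneratorRoad.charIdeal_map_le_span_of_generatorSkeleton₂` — **ROAD G END FORM, TWO COPIES**:
  (A.7)′ `ι₁ : P₁/loc₁(S) ↪ X`, (2.3(3))′ `char(X ⧸ ι₁) = char(T)` for a f.g. torsion `T`
  (`= (X_{∅,Gr})_tors`), (A.5) `ι₂ : P₂/loc₂(S) ↪ T`, `e_v : P_v ≃ Λ`, (GEN) `S = Λz`,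
  (ERL²) `φ(e₁(loc₁ z)·e₂(loc₂ z))·w = u·Q` ⟹ `char(X)·Λ' ⊆ (Q)`; `…₂_of_nakayama` (bottom-layer GEN).
* §3 `P2.imcDivIntCoreFrameAtDatum_of_generatorSkeleton₂` — at the tree's `X_ac^∅`: the `∃`-body of
  `P2.IMCDivIntCoreFrameAtErratumData W p` at a datum from a printed frame + the two-copy skeleton for
  its `Q`; `…AtErratumData_of_forall_generatorSkeleton₂` — the ∀-data shape under the ∀-data
  hypothesis (completeness only; UNREALISTIC class-wide, divisible data exist).

HONEST MASS (unchanged): ROAD G never reaches a datum with `p ∣ [E(K):ℤy_K]` — where (2.4) has content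
and where LADDER K2's residual pairs live; it is a witness ∕ structure road (BC5) and a kernel
transfer HPMC-side ⟶ BDP-side, nothing more.

References (locators only): [cite: Castella2018Erratum, (2.4) (p. 4)]; [cite: Castella2018, Thms.
3.1–3.2 (arXiv:1704.06608 p. 9)]; [cite: Castella2018Exceptional, Thms. 2.10–2.11 (arXiv:1507.04260 p. 13–14)];
Castella JLMS 96 (2017) App. A, Lemma 2.3, Lemmas A.2–A.4, (A.5)–(A.7), Thm. A.1, (A.9)
(arXiv:1509.02761 pp. 9–10, 18–20); Burungale–Castella–Kim ANT 15 (2021) Thm. 4.1 (arXiv:1908.09512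
p. 9); Castella arXiv:2409.01360 Thms. 2.1–2.2, Cor. 2.3, Prop. 3.2 (PREPRINT); Mazur–Rubin, *Kolyvagin
systems*, Lem. 3.5.3, Thm. 4.1.13; Washington GTM 83 §13.2; Bourbaki AC VII §4.5 Prop. 10.
-/

noncomputable section

open scoped Classical

open WeierstrassCurve NumberField IsDedekindDomain Field PowerSeries
open Literature.NumberTheory.EllipticCurves Literature.NumberTheory.EllipticCurves.GreenbergSelmer
open Literature.NumberTheory.EllipticCurves.ModularForms
open Literature.NumberTheory.EllipticCurves.Rank1Residual
open Literature.NumberTheory.EllipticCurves.Rank1Residual.Typed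
open Literature.NumberTheory.EllipticCurves.Castella2018
open Literature.NumberTheory.GaloisRepresentations
open Literature.NumberTheory.GaloisCohomology
open Summit.BirchSwinnertonDyer.Rank1Residual.X11b.AcSelmer
open Summit.BirchSwinnertonDyer.Rank1Residual.X11b.Halves

namespace Summit.BirchSwinnertonDyer.Rank1Residual.X11b

namespace GeneratorRoad

open Literature.NumberTheory.EllipticCurves.Module

/-! ### §1 Generic: `R⧸(a) ↪ X` and a bound on the quotient give `char X ⊆ (a)·J` -/

section Generic

variable {R : Type*} [CommRing R] {X : Type*} [AddCommGroup X] [Module R X]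

/-- The characteristic ideal is invariant under linear equivalences (so are all local lengths,
`lengthAt_eq_of_linearEquiv`). [folklore] -/
theorem charIdeal_eq_of_linearEquiv' {M N : Type*} [AddCommGroup M] [Module R M] [AddCommGroup N]
    [Module R N] (e : M ≃ₗ[R] N) : charIdeal R M = charIdeal R N := by
  unfold charIdeal
  exact finprod_mem_congr rfl fun 𝔭 _ => by rw [lengthAt_eq_of_linearEquiv e 𝔭]

/-- **`R ⧸ (a) ↪ X` and `char(X ⧸ R⧸(a)) ⊆ J` ⟹ `char(X) ⊆ (a)·J`** for a finitely generated torsion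
module over a Noetherian factorial domain (multiplicativity of `char` in `0 → R⧸(a) → X → X⧸(R⧸(a)) → 0`
and `char(R⧸(a)) = (a)`; `a ≠ 0` is forced by torsion-ness). The algebra of «(A.7)′ + a bound on
`Ch(X_{0,Gr})`». [cite: Washington1997, §13.2] [cite: BourbakiAC5to7, Ch. VII §4 no. 5, Prop. 10] -/
theorem charIdeal_le_span_mul_of_injective_of_quotient_le [IsDomain R] [IsNoetherianRing R]
    [UniqueFactorizationMonoid R] [Module.Finite R X] (hX : Module.IsTorsion R X) {a : R}
    (ι : (R ⧸ Ideal.span {a}) →ₗ[R] X) (hι : Function.Injective ι) {J : Ideal R}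
    (hJ : charIdeal R (X ⧸ LinearMap.range ι) ≤ J) : charIdeal R X ≤ Ideal.span {a} * J := by
  have ha : a ≠ 0 := ne_zero_of_injective_of_isTorsion hX ι hι
  rw [charIdeal_eq_mul_of_exact hX ι (LinearMap.range ι).mkQ hι (Submodule.mkQ_surjective _)
    (LinearMap.exact_map_mkQ_range ι), charIdeal_quotient_span_singleton ha]
  exact Ideal.mul_mono_right hJ

/-- **Two-factor units transport**: `char(X) ⊆ (a·b)` in `R` and `φ(a·b)·w = u·Q` with `w, u` units
of `R'` ⟹ `char(X)·R' ⊆ (Q)`. [cite: Washington1997, §13.2] -/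
theorem map_le_span_of_le_span_of_units {R' : Type*} [CommRing R'] (φ : R →+* R') {I : Ideal R}
    {c : R} (hI : I ≤ Ideal.span {c}) {w u Q : R'} (hw : IsUnit w) (hu : IsUnit u)
    (hQ : φ c * w = u * Q) : I.map φ ≤ Ideal.span {Q} := by
  have h1 : I.map φ ≤ (Ideal.span {c}).map φ := Ideal.map_mono hI
  rw [Ideal.map_span, Set.image_singleton] at h1
  have h2 : Ideal.span {φ c} = Ideal.span {Q} := by
    rw [← Ideal.span_singleton_mul_right_unit hw, hQ, Ideal.span_singleton_mul_left_unit hu]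
  rwa [h2] at h1

end Generic

/-! ### §2 ROAD G END FORM with both Coleman cokernels -/

section EndForm

variable {p : ℕ} [Fact p.Prime] {Λ' : Type*} [CommRing Λ'] (φ : IwasawaAlgebra p →+* Λ')
  {X : Type*} [AddCommGroup X] [Module (IwasawaAlgebra p) X]
  {T : Type*} [AddCommGroup T] [Module (IwasawaAlgebra p) T]
  {S P₁ P₂ : Type*} [AddCommGroup S] [Module (IwasawaAlgebra p) S] [AddCommGroup P₁]
  [Module (IwasawaAlgebra p) P₁] [AddCommGroup P₂] [Module (IwasawaAlgebra p) P₂]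

/-- **ROAD G END FORM, TWO COPIES.** Over `Λ = ℤ_p⟦T⟧`: `X` f.g. torsion (`X_{0,∅} = X_ac^∅`); `T` f.g.
torsion (`(X_{∅,Gr})_tors`); `S` with `z` (`𝔖_p`, `κ_∞^*`) and (GEN) `S = Λz`; for `v ∈ {𝔭̄, 𝔭}` local
modules `P₁, P₂` free of rank one (`e_v : P_v ≃ Λ`; `H¹_Gr(K_v, 𝐓)`, Cas24 Thm. 2.2 ∕ Cor. 2.3 +
descent) with `loc_v : S → P_v`; **(A.7)′** `ι₁ : P₁/loc₁(S) ↪ X`; **(2.3(3))′** `char(X ⧸ ι₁) = char(T)`;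
**(A.5)** `ι₂ : P₂/loc₂(S) ↪ T`; **(ERL²)** `φ(e₁(loc₁ z)·e₂(loc₂ z))·w = u·Q`, `w, u` units (the two
explicit reciprocity laws and `𝓛_𝔭̄·𝓛_𝔭 = Q·unit`). THEN `char_Λ(X)·Λ' ⊆ (Q)` — erratum (2.4) for this
`Q`. Module theory only. [cite: Castella2018Erratum, (2.4) (p. 4)] [cite: Washington1997, §13.2] -/
theorem charIdeal_map_le_span_of_generatorSkeleton₂ [Module.Finite (IwasawaAlgebra p) X]
    [Module.Finite (IwasawaAlgebra p) T] (hX : Module.IsTorsion (IwasawaAlgebra p) X)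
    (hT : Module.IsTorsion (IwasawaAlgebra p) T) (z : S)
    (hgen : Submodule.span (IwasawaAlgebra p) {z} = ⊤)
    (loc₁ : S →ₗ[IwasawaAlgebra p] P₁) (e₁ : P₁ ≃ₗ[IwasawaAlgebra p] IwasawaAlgebra p)
    (ι₁ : (P₁ ⧸ LinearMap.range loc₁) →ₗ[IwasawaAlgebra p] X) (hι₁ : Function.Injective ι₁)
    (h233 : Literature.NumberTheory.EllipticCurves.Module.charIdeal (IwasawaAlgebra p)
        (X ⧸ LinearMap.range ι₁) =
      Literature.NumberTheory.EllipticCurves.Module.charIdeal (IwasawaAlgebra p) T)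
    (loc₂ : S →ₗ[IwasawaAlgebra p] P₂) (e₂ : P₂ ≃ₗ[IwasawaAlgebra p] IwasawaAlgebra p)
    (ι₂ : (P₂ ⧸ LinearMap.range loc₂) →ₗ[IwasawaAlgebra p] T) (hι₂ : Function.Injective ι₂)
    {w u Q : Λ'} (hw : IsUnit w) (hu : IsUnit u)
    (hERL : φ (e₁ (loc₁ z) * e₂ (loc₂ z)) * w = u * Q) :
    (Literature.NumberTheory.EllipticCurves.Module.charIdeal (IwasawaAlgebra p) X).map φ ≤
      Ideal.span {Q} := by
  obtain ⟨ε₁⟩ := exists_linearEquiv_quotient_range_of_span_eq_top loc₁ z e₁ hgen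
  obtain ⟨ε₂⟩ := exists_linearEquiv_quotient_range_of_span_eq_top loc₂ z e₂ hgen
  -- the second copy: `Λ/(a₂) ↪ T` gives `char T ⊆ (a₂)`
  have hT₂ : Literature.NumberTheory.EllipticCurves.Module.charIdeal (IwasawaAlgebra p) T ≤
      Ideal.span {e₂ (loc₂ z)} :=
    charIdeal_le_span_singleton_of_injective hT (ι₂ ∘ₗ (ε₂.symm : _ →ₗ[IwasawaAlgebra p] _))
      (hι₂.comp ε₂.symm.injective)
  -- the first copy: `Λ/(a₁) ↪ X` with quotient of characteristic ideal `char T ⊆ (a₂)`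
  set ι₁' : (IwasawaAlgebra p ⧸ Ideal.span {e₁ (loc₁ z)}) →ₗ[IwasawaAlgebra p] X :=
    ι₁ ∘ₗ (ε₁.symm : _ →ₗ[IwasawaAlgebra p] _) with hι₁'_def
  have hrange : LinearMap.range ι₁' = LinearMap.range ι₁ := by
    rw [hι₁'_def, LinearMap.range_comp, LinearEquiv.range, Submodule.map_top]
  have hquot : Literature.NumberTheory.EllipticCurves.Module.charIdeal (IwasawaAlgebra p)
      (X ⧸ LinearMap.range ι₁') ≤ Ideal.span {e₂ (loc₂ z)} := by
    rw [charIdeal_eq_of_linearEquiv' (Submodule.quotEquivOfEq _ _ hrange), h233]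
    exact hT₂
  have hX₁₂ := charIdeal_le_span_mul_of_injective_of_quotient_le hX ι₁'
    (hι₁.comp ε₁.symm.injective) hquot
  rw [Ideal.span_singleton_mul_span_singleton] at hX₁₂
  exact map_le_span_of_le_span_of_units φ hX₁₂ hw hu hERL

end EndForm

end GeneratorRoad

/-! ### §3 At the tree's `X_ac^∅(E[p^∞])`: the `∃`-body of the crux shape AT A DATUM (two copies) -/

section Datum

variable {W : WeierstrassCurve ℚ} [W.IsElliptic] [W.IsGloballyMinimal] {p : ℕ} [Fact p.Prime]
  {K : Type} [Field K] [NumberField K]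

omit [W.IsGloballyMinimal] in
/-- **H3♭ CORE AT A GENERATOR DATUM — two-copy form.** GIVEN a printed frame `(Ω_K ≠ 0, ‖Ω_p‖ = 1, Q)`
with Castella's interpolation property (Cas18 Thm. 3.1: `Q = 𝓛_𝔭(f)²` read in `𝓞_{ℂ_p}⟦T⟧`),
torsion-ness of the real `X_ac^∅(E_K[p^∞])` (tree theorem at erratum data), and the two-copy skeleton
for that `Q` — (A.7)′ at `𝔭̄` into `X_ac^∅`, (2.3(3))′ + (A.5) at `𝔭` into the auxiliary torsion module
`T = (X_{∅,Gr})_tors`, (GEN), and (ERL²) `φ(a_𝔭̄·a_𝔭)·w = u·Q` (Cas24 Thm. 2.2 ∕ Cor. 2.3 at both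
primes above `p`, PREPRINT, and `𝓛_𝔭̄𝓛_𝔭 = Q·unit`) — the `∃`-body of
`P2.IMCDivIntCoreFrameAtErratumData W p` at the datum holds with this frame. CONDITIONAL on the
skeleton hypotheses; nothing booked; nothing claimed at a divisible datum.
[cite: Castella2018, Thm. 3.1 and display (3.2) (arXiv:1704.06608 p. 9)]
[cite: Castella2018Erratum, (2.4) (p. 4)] -/
theorem P2.imcDivIntCoreFrameAtDatum_of_generatorSkeleton₂ [NeZero (W.conductorNorm ℤ)]
    (Dt : ModularParametrizationData W (W.conductorNorm ℤ)) (w₀ : InfinitePlace K)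
    (κ : ZpExtension K p) (γ : Field.absoluteGaloisGroup K) [Fact (κ.IsTopGenerator γ)]
    (ι' : PadicAlgCl p ≃+* ℂ) {ΩK : ℂ} {Ωp : ℂ_[p]} {Q : PowerSeries 𝓞_ℂ_[p]}
    (hΩ : ΩK ≠ 0) (hΩp : ‖Ωp‖ = 1)
    (hQ : R1.IsBDPLFunctionInt p ι' (primeOfEmbeddingDatum p ι' w₀.embedding) κ γ Dt.f ΩK Ωp Q)
    (hXt : Module.IsTorsion (IwasawaAlgebra p)
      (XAc (W.baseChange K) p κ (primeOfEmbeddingDatum p ι' w₀.embedding) ∅ γ))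
    {T S P₁ P₂ : Type*} [AddCommGroup T] [Module (IwasawaAlgebra p) T]
    [Module.Finite (IwasawaAlgebra p) T] [AddCommGroup S] [Module (IwasawaAlgebra p) S]
    [AddCommGroup P₁] [Module (IwasawaAlgebra p) P₁] [AddCommGroup P₂] [Module (IwasawaAlgebra p) P₂]
    (hT : Module.IsTorsion (IwasawaAlgebra p) T) (z : S)
    (hgen : Submodule.span (IwasawaAlgebra p) {z} = ⊤)
    (loc₁ : S →ₗ[IwasawaAlgebra p] P₁) (e₁ : P₁ ≃ₗ[IwasawaAlgebra p] IwasawaAlgebra p)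
    (ι₁ : (P₁ ⧸ LinearMap.range loc₁) →ₗ[IwasawaAlgebra p]
      XAc (W.baseChange K) p κ (primeOfEmbeddingDatum p ι' w₀.embedding) ∅ γ)
    (hι₁ : Function.Injective ι₁)
    (h233 : Literature.NumberTheory.EllipticCurves.Module.charIdeal (IwasawaAlgebra p)
        (XAc (W.baseChange K) p κ (primeOfEmbeddingDatum p ι' w₀.embedding) ∅ γ ⧸
          LinearMap.range ι₁) =
      Literature.NumberTheory.EllipticCurves.Module.charIdeal (IwasawaAlgebra p) T)
    (loc₂ : S →ₗ[IwasawaAlgebra p] P₂) (e₂ : P₂ ≃ₗ[IwasawaAlgebra p] IwasawaAlgebra p)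
    (ι₂ : (P₂ ⧸ LinearMap.range loc₂) →ₗ[IwasawaAlgebra p] T) (hι₂ : Function.Injective ι₂)
    {w u : PowerSeries 𝓞_ℂ_[p]} (hw : IsUnit w) (hu : IsUnit u)
    (hERL : PowerSeries.map (R1.toCpInt p) (e₁ (loc₁ z) * e₂ (loc₂ z)) * w = u * Q) :
    ∃ (ΩK : ℂ) (Ωp : ℂ_[p]) (Q : PowerSeries 𝓞_ℂ_[p]), ΩK ≠ 0 ∧ ‖Ωp‖ = 1 ∧
      R1.IsBDPLFunctionInt p ι' (primeOfEmbeddingDatum p ι' w₀.embedding) κ γ Dt.f ΩK Ωp Q ∧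
      (XAc.charIdeal (W.baseChange K) p κ (primeOfEmbeddingDatum p ι' w₀.embedding) ∅ γ).map
          (PowerSeries.map (R1.toCpInt p)) ≤ Ideal.span {Q} := by
  haveI : Module.Finite (IwasawaAlgebra p)
      (XAc (W.baseChange K) p κ (primeOfEmbeddingDatum p ι' w₀.embedding) ∅ γ) :=
    XAc.module_finite_empty κ _ γ
  exact ⟨ΩK, Ωp, Q, hΩ, hΩp, hQ,
    GeneratorRoad.charIdeal_map_le_span_of_generatorSkeleton₂ (PowerSeries.map (R1.toCpInt p)) hXt
      hT z hgen loc₁ e₁ ι₁ hι₁ h233 loc₂ e₂ ι₂ hι₂ hw hu hERL⟩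

/-- **The ∀-data CORE shape `P2.IMCDivIntCoreFrameAtErratumData W p`** (crux 19270's currency; both
registered stubs' conclusions) **under the ∀-DATA two-copy ROAD G hypothesis** — binders VERBATIM those
of the shape. Completeness ONLY: UNREALISTIC class-wide (divisible data exist at every pair); it records
the logical relation of ROAD G to the stubs. CONDITIONAL; nothing booked.
[cite: Castella2018Erratum, (2.4) (p. 4)] [cite: Castella2018, Thm. 3.1 (arXiv:1704.06608 p. 9)] -/
theorem P2.imcDivIntCoreFrameAtErratumData_of_forall_generatorSkeleton₂
    (hG : ∀ [NeZero (W.conductorNorm ℤ)] (q : ℕ) [Fact q.Prime] (K : Type) [Field K] [NumberField K]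
      (Dt : ModularParametrizationData W (W.conductorNorm ℤ))
      (H : HeegnerDatum (W.conductorNorm ℤ) (NumberField.discr K)) (w₀ : InfinitePlace K)
      (P : (W.baseChange K).toAffine.Point), ErratumHypotheses W p → W.analyticRank = 1 →
      q ≠ p → Mult W q → ¬ W.HasSplitMultiplicativeReductionAtPrime q →
      ¬ p ∣ padicValInt q W.minimalDiscriminantInt → IsErratumField W K q →
      Cas20Standing K p (W.conductorNorm ℤ / p) →
      WeierstrassCurve.Affine.Point.map w₀.embedding.toRatAlgHom P = heegnerPointComplex Dt H →
      ¬ (p : ℤ) ∣ Dt.c → ¬ IsOfFinAddOrder P →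
      ∀ (κ : ZpExtension K p), κ.IsAnticyclotomic →
        ∀ (γ : Field.absoluteGaloisGroup K) [Fact (κ.IsTopGenerator γ)] (ι' : PadicAlgCl p ≃+* ℂ)
          (e : K →+* ℚ_[p]),
          (∀ k : 𝓞 K, k ∈ (primeOfEmbeddingDatum p ι' w₀.embedding).asIdeal ↔ ‖e (k : K)‖ < 1) →
          ∃ (ΩK : ℂ) (Ωp : ℂ_[p]) (Q : PowerSeries 𝓞_ℂ_[p]), ΩK ≠ 0 ∧ ‖Ωp‖ = 1 ∧
            R1.IsBDPLFunctionInt p ι' (primeOfEmbeddingDatum p ι' w₀.embedding) κ γ Dt.f ΩK Ωp Q ∧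
            Module.IsTorsion (IwasawaAlgebra p)
              (XAc (W.baseChange K) p κ (primeOfEmbeddingDatum p ι' w₀.embedding) ∅ γ) ∧
            ∃ (T S P₁ P₂ : Type) (_ : AddCommGroup T) (_ : Module (IwasawaAlgebra p) T)
              (_ : Module.Finite (IwasawaAlgebra p) T)
              (_ : AddCommGroup S) (_ : Module (IwasawaAlgebra p) S)
              (_ : AddCommGroup P₁) (_ : Module (IwasawaAlgebra p) P₁)
              (_ : AddCommGroup P₂) (_ : Module (IwasawaAlgebra p) P₂)
              (z : S) (loc₁ : S →ₗ[IwasawaAlgebra p] P₁) (e₁ : P₁ ≃ₗ[IwasawaAlgebra p] IwasawaAlgebra p)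
              (ι₁ : (P₁ ⧸ LinearMap.range loc₁) →ₗ[IwasawaAlgebra p]
                XAc (W.baseChange K) p κ (primeOfEmbeddingDatum p ι' w₀.embedding) ∅ γ)
              (loc₂ : S →ₗ[IwasawaAlgebra p] P₂) (e₂ : P₂ ≃ₗ[IwasawaAlgebra p] IwasawaAlgebra p)
              (ι₂ : (P₂ ⧸ LinearMap.range loc₂) →ₗ[IwasawaAlgebra p] T) (w u : PowerSeries 𝓞_ℂ_[p]),
              Module.IsTorsion (IwasawaAlgebra p) T ∧ Submodule.span (IwasawaAlgebra p) {z} = ⊤ ∧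
              Function.Injective ι₁ ∧
              Literature.NumberTheory.EllipticCurves.Module.charIdeal (IwasawaAlgebra p)
                  (XAc (W.baseChange K) p κ (primeOfEmbeddingDatum p ι' w₀.embedding) ∅ γ ⧸
                    LinearMap.range ι₁) =
                Literature.NumberTheory.EllipticCurves.Module.charIdeal (IwasawaAlgebra p) T ∧
              Function.Injective ι₂ ∧ IsUnit w ∧ IsUnit u ∧
              PowerSeries.map (R1.toCpInt p) (e₁ (loc₁ z) * e₂ (loc₂ z)) * w = u * Q) :
    P2.IMCDivIntCoreFrameAtErratumData W p := by
  intro _ q _ K _ _ Dt H w₀ P hE hr hqp hmq hns hvq hK hCas hP hc hinf κ hκ γ _ ι' e he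
  obtain ⟨ΩK, Ωp, Q, hΩ, hΩp, hQ, hXt, T, S, P₁, P₂, _, _, _, _, _, _, _, _, _, z, loc₁, e₁, ι₁,
    loc₂, e₂, ι₂, w, u, hT, hgen, hι₁, h233, hι₂, hw, hu, hERL⟩ :=
    hG q K Dt H w₀ P hE hr hqp hmq hns hvq hK hCas hP hc hinf κ hκ γ ι' e he
  exact P2.imcDivIntCoreFrameAtDatum_of_generatorSkeleton₂ Dt w₀ κ γ ι' hΩ hΩp hQ hXt hT z hgen
    loc₁ e₁ ι₁ hι₁ h233 loc₂ e₂ ι₂ hι₂ hw hu hERL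

end Datum

end Summit.BirchSwinnertonDyer.Rank1Residual.X11b
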